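/-
Origin: expansion seat `prover-pub-hodgecm-mc-binder-2-g12-0`, handover #63 2026-08-20T06:45Z md5 22989da6af59 (126 l.; CERTIFIED same mirror: rc 0 / 0 err / 0 warn / 15 s; `#print axioms` of isPlaceIsotypic_of_mem_detIsotypicPolys · mem_span_placeProducts_of_mem_detIsotypicPolys ⊆ trio (`g12/certs/axioms-63.log`); imports #61 `DenseLetters`, #62 `LettEquiv`, K-1 `Vendored/H21/NumberTheory/Weil1964/ArchPlaceCompactSliceCharacter` + `Vendored/H21/RepresentationTheory/PolynomialPlaceIsotypic` (RUN 35); (J-dense)(iv-a): K_∞-ISOTYPIC ⇒ PLACE-ISOTYPIC ⇒ SUMS OF PLACE PRODUCTS: abbrev `VLetterFam V` (= `Π_w U(V⁺_w) × U(V⁻_w)`), **`localLetterBlock V S w : U(V⁺_w) × U(V⁻_w) →* U(6)`** (`x ↦ (dualPairι (x,(1,1)))^{pairFrame_w}`), `localLetterBlock_apply`, `letterBlockOf_kVLetters` (`letterBlockOf (kVLetters a) = placeBlock (w ↦ localLetterBlock w (a w))`, #32 `cmLetterBlock_apply`), `localLetterBlock_mulSingle`, **`pinPlaceOp v a := linSubst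 (star (localLetterBlock v (a v)))`** on `ℂ[Fin 6]`, **`pinPlaceEig v a := dVIota ((Pi.mulSingle v (a v)) v₁)`**, **`isPlaceIsotypic_of_mem_detIsotypicPolys : G ∈ detIsotypicPolys V S → IsPlaceIsotypic (pinPlaceOp V S) (pinPlaceEig V S) G`** (#62 `lett_lettInv` at the single-place family `Pi.mulSingle v (a v)` + tree `star_coe_placeBlock_mulSingle` + `linSubst_blockDiagonal_mulSingle` = `placeMap v`), **`mem_span_placeProducts_of_mem_detIsotypicPolys : G ∈ detIsotypicPolys V S → G ∈ span (placeProducts (pinPlaceOp V S) (pinPlaceEig V S))`** (tree `mem_span_placeProducts_of_isPlaceIsotypic`, Goodman–Wallach §4.2.1): every K_∞-isotypic polynomial (given hκ, #61) is a finite sum of `∏_w rename (atPlace w) p_w` with `p_w ∈ ℂ[Fin 6]` a joint eigenvector of the place-w letter substitutions (eigenvalue `dVIota 1` off `w(ι₁)`, `dVIota (a v₁)` at `w(ι₁)`); REMAINING for `dense` ((iv-b/c), per place, in `ℂ[Fin 6]`): joint eigenspace of `pinPlaceOp w` ⊆ embedded printed module `embOf … w (M_w)` (Σ: #20; D: #21;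 ι₁: tree `FockRowDeterminantIsotypic`), then `insPoly_tprod` puts the product in `range insPoly` and #60 closes `hdense`; 0 Prop-defs / 0 records / 0 proof-hole-class tokens; FQN scan: 0 collisions; NAME LIST `HodgeCM.Model.HypCensus.mem_span_placeProducts_of_mem_detIsotypicPolys` · `HodgeCM.Model.HypCensus.isPlaceIsotypic_of_mem_detIsotypicPolys` · `HodgeCM.Model.HypCensus.localLetterBlock`) (`HOME/mc/pub-hodgecm-mc-binder-2/g12/pkg/HodgeCM/Model/HypCensus/DensePlace.lean`, md5 22989da6af59, 126 lines);
landed by the gen-16 packager (p-g16) in gate run 43 as `HodgeCM/Model/HypCensus/DensePlace.lean` (verbatim).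
-/
/-
Copyright (c) 2026. All rights reserved.
Released under Apache 2.0 license as described in the file LICENSE.
-/
import Summits.HodgeConjecture.HodgeCM.Model.HypCensus.DenseLetters
import Summits.HodgeConjecture.HodgeCM.Model.HypCensus.LettEquiv
import Literature.NumberTheory.Weil1964.ArchPlaceCompactSliceCharacter
import Literature.RepresentationTheory.PolynomialPlaceIsotypic

/-!
# (J-dense), step (iv-a): `K_∞`-isotypic polynomials are PLACE-isotypic, hence sums of place products

Binder-2 lineage, rows 18/19 (`hyp12`/`hyp34`), field `dense` of `HypCoreW`.

With #62 (`lettEquiv : K_∞ ≃* Π_w U(V⁺_w) × U(V⁻_w)`) a polynomial in #61's `detIsotypicPolys` is an eigenvector of the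
substitution by EVERY letter family, in particular by the single-place families `Pi.mulSingle v x`; the letter block of
such a family is `placeBlock (Pi.mulSingle v (localLetterBlock v x))`, whose substitution IS the tree's `placeMap v`
(`star_coe_placeBlock_mulSingle` + `linSubst_blockDiagonal_mulSingle`).  So

* `isPlaceIsotypic_of_mem_detIsotypicPolys`: `G ∈ detIsotypicPolys ⇒ IsPlaceIsotypic pinPlaceOp pinPlaceEig G`;
* `mem_span_placeProducts_of_mem_detIsotypicPolys`: `G ∈ span (placeProducts pinPlaceOp pinPlaceEig)` (tree
  `mem_span_placeProducts_of_isPlaceIsotypic`, Goodman–Wallach §4.2.1): `G` is a finite sum of products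
  `∏_w rename (atPlace w) p_w` of PER-PLACE joint eigenvectors `p_w ∈ ℂ[Fin 6]` of the place-`w` letter substitutions
  (eigenvalue `1` off `w(ι₁)`, `dVIota` at `w(ι₁)`).
What remains of (J-dense)(iv) after this file is per-place classical invariant theory in `ℂ[Fin 6]` (Σ: #20, D: #21,
ι₁: tree `FockRowDeterminantIsotypic`) identifying those joint eigenspaces with the embedded printed modules.
[folklore; GoodmanWallach2009 §4.2.1]
-/

noncomputable section

open NumberField NumberField.InfinitePlace IsDedekindDomain
open scoped Matrix Classical TensorProduct
open MvPolynomial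
open Literature.NumberTheory.Automorphic Literature.NumberTheory.Automorphic.UnitaryGroup Literature.NumberTheory.Weil1964
open Literature.RepresentationTheory.KonnoKonno2007 Literature.RepresentationTheory.KonnoKonno2007.RealDualPair
open Literature.NumberTheory.GelbartRogawski1991 Literature.NumberTheory.GelbartRogawski1991.UnitaryDualPair
open Literature.Analysis.SegalBargmann Literature.RepresentationTheory
open HodgeCM HodgeCM.Model

namespace HodgeCM.Model.HypCensus

section Pin

variable {L : CMField} {ι₁ : L →+* ℂ} (V : HermSpace3 L ι₁) (S : StubTree.SeesawDatum L)

/-- the type of `V`-letter families `Π_w U(V⁺_w) × U(V⁻_w)`. -/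
abbrev VLetterFam : Type :=
  ∀ w : {v : InfinitePlace ↥(maximalRealSubfield L) // v.IsReal},
    Matrix.unitaryGroup (PosIdx (cmXV (L : Type) (frameD V) (frameD_real V) ι₁ w)) ℂ ×
      Matrix.unitaryGroup (NegIdx (cmXV (L : Type) (frameD V) (frameD_real V) ι₁ w)) ℂ

/-- **the place-`w` block of a `V`-letter**: `(dualPairι (x, (1,1)))^{pairFrame_w} ∈ U(6)`. -/
def localLetterBlock (w : {v : InfinitePlace ↥(maximalRealSubfield L) // v.IsReal}) :
    Matrix.unitaryGroup (PosIdx (cmXV (L : Type) (frameD V) (frameD_real V) ι₁ w)) ℂ ×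
        Matrix.unitaryGroup (NegIdx (cmXV (L : Type) (frameD V) (frameD_real V) ι₁ w)) ℂ →*
      Matrix.unitaryGroup (Fin 6) ℂ :=
  (reindexUnitary (pairFrame (PosIdx (cmXV (L : Type) (frameD V) (frameD_real V) ι₁ w))
      (NegIdx (cmXV (L : Type) (frameD V) (frameD_real V) ι₁ w)) (PosIdx (cmXW (L : Type) (frameD V) (dW S) (dW_real S) ι₁ w))
      (NegIdx (cmXW (L : Type) (frameD V) (dW S) (dW_real S) ι₁ w)) finProdFinEquiv (cmEpsV (L : Type) (frameD V) (frameD_real V) ι₁ w)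
      (cmEpsW (L : Type) (frameD V) (dW S) (dW_real S) ι₁ w))).comp
    ((dualPairι (P := PosIdx (cmXV (L : Type) (frameD V) (frameD_real V) ι₁ w)) (Q := NegIdx (cmXV (L : Type) (frameD V) (frameD_real V) ι₁ w))
        (R := PosIdx (cmXW (L : Type) (frameD V) (dW S) (dW_real S) ι₁ w)) (S := NegIdx (cmXW (L : Type) (frameD V) (dW S) (dW_real S) ι₁ w))).comp
      ((MonoidHom.id _).prod 1))

/-- (Ported verbatim from the HodgeCMPerL package; no docstring in the source.) -/
theorem localLetterBlock_apply (w : {v : InfinitePlace ↥(maximalRealSubfield L) // v.IsReal})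
    (x : Matrix.unitaryGroup (PosIdx (cmXV (L : Type) (frameD V) (frameD_real V) ι₁ w)) ℂ ×
      Matrix.unitaryGroup (NegIdx (cmXV (L : Type) (frameD V) (frameD_real V) ι₁ w)) ℂ) :
    localLetterBlock V S w x =
      reindexUnitary (pairFrame (PosIdx (cmXV (L : Type) (frameD V) (frameD_real V) ι₁ w))
        (NegIdx (cmXV (L : Type) (frameD V) (frameD_real V) ι₁ w)) (PosIdx (cmXW (L : Type) (frameD V) (dW S) (dW_real S) ι₁ w))
        (NegIdx (cmXW (L : Type) (frameD V) (dW S) (dW_real S) ι₁ w)) finProdFinEquiv (cmEpsV (L : Type) (frameD V) (frameD_real V) ι₁ w)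
        (cmEpsW (L : Type) (frameD V) (dW S) (dW_real S) ι₁ w))
        (dualPairι (x, (1, 1))) := rfl

/-- the letter block of a family is the place block of its local blocks (#32 `cmLetterBlock_apply`). -/
theorem letterBlockOf_kVLetters (a : VLetterFam V) :
    letterBlockOf (L : Type) (frameD V) (frameD_real V) (dW S) (dW_real S) ι₁ (kVLetters V S a) =
      placeBlock fun w => localLetterBlock V S w (a w) := by
  unfold letterBlockOf
  rw [cmLetterBlock_apply]
  rfl

/-- local blocks of a single-place family. -/
theorem localLetterBlock_mulSingle (v : {v : InfinitePlace ↥(maximalRealSubfield L) // v.IsReal})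
    (x : Matrix.unitaryGroup (PosIdx (cmXV (L : Type) (frameD V) (frameD_real V) ι₁ v)) ℂ ×
      Matrix.unitaryGroup (NegIdx (cmXV (L : Type) (frameD V) (frameD_real V) ι₁ v)) ℂ) :
    (fun w => localLetterBlock V S w ((Pi.mulSingle v x : VLetterFam V) w)) = Pi.mulSingle v (localLetterBlock V S v x) := by
  funext w
  by_cases hw : w = v
  · subst hw
    rw [Pi.mulSingle_eq_same, Pi.mulSingle_eq_same]
  · rw [Pi.mulSingle_eq_of_ne hw, Pi.mulSingle_eq_of_ne hw, map_one]

/-- **the place-`v` operator family of the pin** on `ℂ[Fin 6]`: substitution by the local block of the `v`-letter. -/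
def pinPlaceOp (v : {v : InfinitePlace ↥(maximalRealSubfield L) // v.IsReal}) (a : VLetterFam V) :
    MvPolynomial (Fin 6) ℂ →ₐ[ℂ] MvPolynomial (Fin 6) ℂ :=
  linSubst (star ((localLetterBlock V S v (a v) : Matrix.unitaryGroup (Fin 6) ℂ) : Matrix (Fin 6) (Fin 6) ℂ))

/-- **the place-`v` eigenvalues of the pin**: `dVIota` of the `ι₁`-letter of the single-place family (so `dVIota (a v₁)` at
`v = v₁ = w(ι₁)` and `dVIota 1` elsewhere). -/
def pinPlaceEig (v : {v : InfinitePlace ↥(maximalRealSubfield L) // v.IsReal}) (a : VLetterFam V) : ℂ :=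
  dVIota V S ((Pi.mulSingle v (a v) : VLetterFam V) (cmPlace (L : Type) ι₁))

/-- **`K_∞`-isotypic ⇒ place-isotypic.** -/
theorem isPlaceIsotypic_of_mem_detIsotypicPolys
    {G : MvPolynomial (Fin 6 × {v : InfinitePlace ↥(maximalRealSubfield L) // v.IsReal}) ℂ} (hG : G ∈ detIsotypicPolys V S) :
    IsPlaceIsotypic (pinPlaceOp V S) (pinPlaceEig V S) G := by
  intro v a
  have h := hG.2 (lettInv V S (Pi.mulSingle v (a v)))
  rw [lett_lettInv, letterBlockOf_kVLetters, localLetterBlock_mulSingle, star_coe_placeBlock_mulSingle,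
    linSubst_blockDiagonal_mulSingle] at h
  exact h

/-- **`K_∞`-isotypic polynomials are finite sums of products of per-place letter-eigenvectors** (tree
`mem_span_placeProducts_of_isPlaceIsotypic`). [GoodmanWallach2009 §4.2.1] -/
theorem mem_span_placeProducts_of_mem_detIsotypicPolys
    {G : MvPolynomial (Fin 6 × {v : InfinitePlace ↥(maximalRealSubfield L) // v.IsReal}) ℂ} (hG : G ∈ detIsotypicPolys V S) :
    G ∈ Submodule.span ℂ (placeProducts (pinPlaceOp V S) (pinPlaceEig V S)) :=
  mem_span_placeProducts_of_isPlaceIsotypic _ _ (isPlaceIsotypic_of_mem_detIsotypicPolys V S hG)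

end Pin

end HodgeCM.Model.HypCensus

end
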